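import Summits.BirchSwinnertonDyer.BirchSwinnertonDyer.Theorems.ThetaPartnerAtTwoSignedMainConjectureCMTwoRankZeroFlatTwistComposite
import Summits.BirchSwinnertonDyer.BirchSwinnertonDyer.Theorems.ThetaPartnerAtTwoSignedMainConjectureCMTwoRankZeroFlatTwistAnchors
import HarnessLib

/-!
# Route `ThetaPartnerAtTwo`, crux K2r0P `SignedMainConjectureCMTwoRankZeroOfPub` (stmt-BirchSwinnertonDyer-24945),
# line `rankzero` v14, stub (μ♭)_A: ELEMENTARY TWIST TRANSPORT OF FLAT AT `p = 2` for every SQUARE-FREE real quadratic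
# twist — the residual certificate is an invariant of the twist; (μ♭) AT every rank-`0` real square-free twist of a
# print-certified anchor (unit zone, level 16, or any certified sibling)

Cell `bsd-wall`, width seat `bsd-wall-tp2-p2-w3` (g2). THEOREMS ONLY (no `def`, no named fact, no `sorry`); helper `--supports`
the crux; sequel of `…FlatTwistComposite` (the plus-symbol congruence (C) `exists_plusSymbol_congruence_twist_squarefree` for a
habitat curve `W` and a globally minimal model `A` of `W^{(d)}`, `d > 0` SQUARE-FREE, `d ≡ 1 (mod 4)`, `(d, N_W) = 1`, granted
modularity `hmod` and the period unit at `2` `h2`) and of `…FlatTwistAnchors` (the prime case, whose statements these generalise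
word for word: `d = 21, 33, 57, 65, 77, …` are now admissible). Namespace `…Theorems.FlatTwist.Squarefree`. Nothing about any
particular curve is asserted; BSD is not proved by any of this.

* §3 `exists_odd_twist_of_exists_odd` / `exists_odd_of_exists_odd_twist` — «some `[b/4^k]⁺ − [0]⁺` (`k ≥ 1`, `b` odd) is half an odd
  integer» holds for `f_W` iff it holds for `f_A`.
* §4 `flatAtTwo_twist_of_exists_odd` (`a₂(W) = 0`, `L(A,1) ≠ 0` ⇒ `2 ∤ L♭` for every Pollack pair of `f_A`),
  `analyticMuFlat_twist_at_of_exists_odd` (stub currency `∃ n, IsUnit (coeff n (kobayashiL 1 L⁺ L⁻))`),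
  `analyticMuFlat_twist_at_of_sibling` (certificate at any square-free sibling `A₁ = W^{(d₁)}`).
* §5 `analyticMuFlat_twist_at_of_unitZone_anchor`, `analyticMuFlat_twist_at_of_levelSixteen_anchor` — PUB (`hBF hmod hLrat hGZK h2`)
  ⇒ (μ♭) AT every rank-`0` real square-free twist of a unit-zone anchor, resp. of an anchor with `N_W ≡ ±1 (mod 8)` and
  `ord₂(#Ш·∏c) = 1`.
* §6 `exists_odd_of_flatAtTwo` — in analytic rank `0`, FLAT in door form («`2 ∤ L♭` for every Pollack pair») gives back the
  residual certificate (some `[b/4^k]⁺ − [0]⁺` is half an odd integer; `b = 5^s mod 2^{n+2}`), so ANY door-certified rank-`0`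
  anchor (an RTT (G′)_N certificate, the Zhai door, …) feeds the transport: `analyticMuFlat_twist_at_of_flatAtTwo_anchor`.

References: B. Mazur, J. Tate, J. Teitelbaum, Invent. Math. 84 (1986) §I.4 (4.2), §I.8 [MazurTateTeitelbaum1986Invent]; V. Pal,
Proc. AMS 140 (2012) Thm. 3.2 [Pal2012]; R. Pollack, Duke Math. J. 118 (2003) Prop. 6.18 [Pollack2003]; S. Kobayashi, Invent.
Math. 152 (2003) Thm. 1.2 [Kobayashi2003]; A. Burungale, M. Flach, Camb. J. Math. (2024) Thm. 1.1 [BurungaleFlach2024];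
A. O. L. Atkin, J. Lehner, Math. Ann. 185 (1970) Thm. 3 [AtkinLehner1970].
-/

set_option autoImplicit false
-- the Theorems namespace of this sub repeats the summit name by design (D-0017 nested layout)
set_option linter.dupNamespace false

noncomputable section

open scoped Classical MatrixGroups ModularForm

namespace Summit.BirchSwinnertonDyer.BirchSwinnertonDyer.Theorems

open scoped NumberField NumberTheorySymbols

open NumberField IsDedekindDomain Rat.HeightOneSpectrum CongruenceSubgroup
  Literature.NumberTheory.EllipticCurves Literature.NumberTheory.GaloisRepresentations
  WeierstrassCurve Literature.NumberTheory.EllipticCurves.ModularForms Literature.NumberTheory.EllipticCurves.Rank1Residual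
  Literature.NumberTheory.EllipticCurves.Rank1Residual.Typed
  Summit.BirchSwinnertonDyer.Rank1Residual Summit.BirchSwinnertonDyer.Rank1Residual.Supersingular

namespace FlatTwist.Squarefree

/-! ## §3. Transport of the residual certificate «some `2([b/4^k]⁺ − [0]⁺)` is odd» along the twist -/

section Transport

variable (W : WeierstrassCurve ℚ) [W.IsElliptic] [W.IsGloballyMinimal] {d : ℤ} {A : WeierstrassCurve ℚ}
  [A.IsElliptic] [A.IsGloballyMinimal] [NeZero (W.conductorNorm ℤ)] [NeZero (A.conductorNorm ℤ)]
  {fW : CuspForm (Gamma0 (W.conductorNorm ℤ)) 2} {fA : CuspForm (Gamma0 (A.conductorNorm ℤ)) 2}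

/-- **ANCHOR ⟹ TWIST.** Same setting as `exists_plusSymbol_congruence_twist` (`W` good at `2` with `2 ∣ a₂(W)`, `d > 0` square-free,
`d ≡ 1 (mod 4)`, `(d, N_W) = 1`, `A` a minimal model of `W^{(d)}`, some `[x]⁺_{f_A} ≠ 0`; `hmod`, `h2` granted). If some
`[b/4^k]⁺_{f_W} − [0]⁺_{f_W}` (`k ≥ 1`, `b` odd) is HALF AN ODD INTEGER, then so is some `[b'/4^{k'}]⁺_{f_A} − [0]⁺_{f_A}` —
the residual FLAT certificate passes from the anchor curve to its real square-free twist (old-class descent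
`SignedMuAtTwo.exists_odd_of_plusSymbol_congruence` fed with the congruence (C) of §2). [cite: MazurTateTeitelbaum1986Invent, §I.8]
[cite: EmertonPollackWeston2006, Lemma 4.4.4] [cite: Pal2012, Thm. 3.2 (case d > 0)] -/
theorem exists_odd_twist_of_exists_odd (hmod : exists_isNewformOf)
    (h2 : Literature.NumberTheory.EllipticCurves.realPeriodRat_eq_unit_mul_plusPeriod_two)
    (hss : GoodSS W 2) (hd : 0 < d) (hd4 : d % 4 = 1) (hsq : Squarefree d)
    (hcop : IsCoprime d (W.conductorNorm ℤ : ℤ)) {C : VariableChange ℚ} (hA : C • W.quadraticTwist (d : ℚ) = A)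
    (hfW : IsNewformOf W fW) (hfA : IsNewformOf A fA) (hnz : ∃ x : ℚ, ratPlusSymbol fA x ≠ 0)
    (hres : ∃ k : ℕ, 1 ≤ k ∧ ∃ b : ℤ, Odd b ∧ ∃ m : ℤ, Odd m ∧
      ratPlusSymbol fW ((b : ℚ) / 4 ^ k) = ratPlusSymbol fW 0 + (m : ℚ) / 2) :
    ∃ k : ℕ, 1 ≤ k ∧ ∃ b : ℤ, Odd b ∧ ∃ m : ℤ, Odd m ∧
      ratPlusSymbol fA ((b : ℚ) / 4 ^ k) = ratPlusSymbol fA 0 + (m : ℚ) / 2 := by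
  haveI : Fact (Nat.Prime 2) := ⟨Nat.prime_two⟩
  obtain ⟨S, hS, hodd, hcong⟩ := exists_plusSymbol_congruence_twist_squarefree W hmod h2 hss hd hd4 hsq hcop hA hfW hfA hnz
  have h2d : ¬ (2 : ℤ) ∣ d := by omega
  obtain ⟨hgoodA, -⟩ := hasGoodReductionAtPrime_twist_and_frobeniusTrace_eq W 2 hmod hd4 hsq hcop hA hss.1 h2d
  have h2NA : ¬ 2 ∣ A.conductorNorm ℤ := not_dvd_level_of_isNewformOf hfA hgoodA
  have h2NW : ¬ 2 ∣ W.conductorNorm ℤ := not_dvd_level_of_isNewformOf hfW hss.1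
  have haW2 : cuspCoeff fW 2 = ((W.frobeniusTrace 2 : ℤ) : ℂ) := cuspCoeff_eq_frobeniusTrace_of_isNewformOf_holds hfW hss.1
  have haev : Even (W.frobeniusTrace 2) := even_iff_two_dvd.mpr hss.2
  exact SignedMuAtTwo.exists_odd_of_plusSymbol_congruence fA fW hfA.coeffField_eq_bot h2NA hfW.1 hfW.coeffField_eq_bot
    h2NW haW2 haev S hS hodd hcong hres

/-- **TWIST ⟹ ANCHOR.** Conversely (same setting, no non-vanishing hypothesis needed): if some
`[b/4^k]⁺_{f_A} − [0]⁺_{f_A}` (`k ≥ 1`, `b` odd) is half an odd integer, then so is some `[tb/4^k]⁺_{f_W} − [0]⁺_{f_W}` with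
`t ∣ d²` — an odd sum of integers has an odd summand. So «FLAT in plus symbols» is an INVARIANT of the real prime
twist. [cite: MazurTateTeitelbaum1986Invent, §I.8] [cite: Pal2012, Thm. 3.2 (case d > 0)] -/
theorem exists_odd_of_exists_odd_twist (hmod : exists_isNewformOf)
    (h2 : Literature.NumberTheory.EllipticCurves.realPeriodRat_eq_unit_mul_plusPeriod_two)
    (hss : GoodSS W 2) (hd : 0 < d) (hd4 : d % 4 = 1) (hsq : Squarefree d)
    (hcop : IsCoprime d (W.conductorNorm ℤ : ℤ)) {C : VariableChange ℚ} (hA : C • W.quadraticTwist (d : ℚ) = A)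
    (hfW : IsNewformOf W fW) (hfA : IsNewformOf A fA)
    (hres : ∃ k : ℕ, 1 ≤ k ∧ ∃ b : ℤ, Odd b ∧ ∃ m : ℤ, Odd m ∧
      ratPlusSymbol fA ((b : ℚ) / 4 ^ k) = ratPlusSymbol fA 0 + (m : ℚ) / 2) :
    ∃ k : ℕ, 1 ≤ k ∧ ∃ b : ℤ, Odd b ∧ ∃ m : ℤ, Odd m ∧
      ratPlusSymbol fW ((b : ℚ) / 4 ^ k) = ratPlusSymbol fW 0 + (m : ℚ) / 2 := by
  obtain ⟨k, hk, b, hb, m, hmo, hmeq⟩ := hres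
  -- some plus symbol of `f_A` is non-zero
  have hnz : ∃ x : ℚ, ratPlusSymbol fA x ≠ 0 := by
    by_contra hall
    push Not at hall
    rw [hall, hall] at hmeq
    have hm0 : (m : ℚ) = 0 := by linarith
    have : m = 0 := by exact_mod_cast hm0
    rw [this] at hmo
    exact (by decide : ¬ Odd (0 : ℤ)) hmo
  obtain ⟨S, hS, hodd, hcong⟩ := exists_plusSymbol_congruence_twist_squarefree W hmod h2 hss hd hd4 hsq hcop hA hfW hfA hnz
  obtain ⟨z, hz⟩ := hcong k hk b hb
  have h2NW : ¬ 2 ∣ W.conductorNorm ℤ := not_dvd_level_of_isNewformOf hfW hss.1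
  have hrealW : ∀ n, (cuspCoeff fW n).im = 0 := cuspCoeff_im_eq_zero_of_coeffField_eq_bot hfW.coeffField_eq_bot
  have h4pow : ((4 : ℚ) ^ k) = 2 ^ (2 * k) := by rw [pow_mul]; norm_num
  have hint : ∀ t : ℕ, ∃ n : ℤ,
      2 * (ratPlusSymbol fW ((((t : ℤ) * b : ℤ) : ℚ) / 4 ^ k) - ratPlusSymbol fW 0) = n := fun t ↦
    SignedMuAtTwo.exists_two_mul_ratPlusSymbol_sub_eq_intCast fW hrealW
      (by rw [h4pow]; exact SignedMuAtTwo.coprime_den_div_two_pow h2NW _ (2 * k))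
  choose n hn using hint
  have hsumQ : ((∑ t ∈ S, n t : ℤ) : ℚ) = m - 2 * z := by
    push_cast
    rw [← Finset.sum_congr rfl fun t _ ↦ hn t, ← hz, hmeq]
    ring
  have hsum : ∑ t ∈ S, n t = m - 2 * z := by exact_mod_cast hsumQ
  have hsodd : Odd (∑ t ∈ S, n t) := by
    rw [hsum]
    exact hmo.sub_even (even_two_mul z)
  obtain ⟨t, ht, hto⟩ : ∃ t ∈ S, Odd (n t) := by
    by_contra hno
    push Not at hno
    have hev : Even (∑ t ∈ S, n t) := Finset.even_sum _ fun t ht ↦ Int.not_odd_iff_even.mp (hno t ht)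
    exact Int.not_odd_iff_even.mpr hev hsodd
  refine ⟨k, hk, (t : ℤ) * b, ?_, n t, hto, ?_⟩
  · exact ((hodd t ht).natCast (R := ℤ)).mul hb
  · have h := hn t
    linear_combination h / 2

end Transport

/-! ## §4. FLAT at the twist (the stub's currency) -/

section Flat

variable (W : WeierstrassCurve ℚ) [W.IsElliptic] [W.IsGloballyMinimal] {d : ℤ} {A : WeierstrassCurve ℚ}
  [A.IsElliptic] [A.IsGloballyMinimal] [NeZero (W.conductorNorm ℤ)] [NeZero (A.conductorNorm ℤ)]
  {fW : CuspForm (Gamma0 (W.conductorNorm ℤ)) 2} {fA : CuspForm (Gamma0 (A.conductorNorm ℤ)) 2}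

/-- **FLAT AT THE REAL SQUARE-FREE TWIST from the anchor's residual certificate.** `W/ℚ` globally minimal, good supersingular at
`2` with `a₂(W) = 0`; `d > 0` square-free, `d ≡ 1 (mod 4)`, `(d, N_W) = 1`; `A` a globally minimal model of `W^{(d)}` with
`L(A,1) ≠ 0`; `f_W`, `f_A` the newforms; grant modularity (`hmod`) and the period unit at `2` (`h2`). If some
`[b/4^k]⁺_{f_W} − [0]⁺_{f_W}` (`k ≥ 1`, `b` odd) is half an odd integer, then `2 ∤ L♭` for EVERY Pollack pair `(L♯, L♭)` of `f_A`
at `2` (μ(L♭_{f_A}) = 0): `A` is again good supersingular at `2` with `a₂(A) = (2/d)·a₂(W) = 0`, and the old-class door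
`SignedMuAtTwo.flatAtTwo_of_plusSymbol_congruence` applies with the congruence (C) of §2. No multiplicity one, no Ihara, no
(G′)_N: one certificate at the anchor serves the whole real-square-free-twist family. BSD is not proved by this.
[cite: Pollack2003, Prop. 6.18] [cite: MazurTateTeitelbaum1986Invent, §I.8] [cite: Pal2012, Thm. 3.2 (case d > 0)] -/
theorem flatAtTwo_twist_of_exists_odd (hmod : exists_isNewformOf)
    (h2 : Literature.NumberTheory.EllipticCurves.realPeriodRat_eq_unit_mul_plusPeriod_two)
    (hss : GoodSS W 2) (haW : W.frobeniusTrace 2 = 0) (hd : 0 < d) (hd4 : d % 4 = 1) (hsq : Squarefree d)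
    (hcop : IsCoprime d (W.conductorNorm ℤ : ℤ)) {C : VariableChange ℚ} (hA : C • W.quadraticTwist (d : ℚ) = A)
    (hfW : IsNewformOf W fW) (hfA : IsNewformOf A fA) (hLA : A.entireLFunction 1 ≠ 0)
    (hres : ∃ k : ℕ, 1 ≤ k ∧ ∃ b : ℤ, Odd b ∧ ∃ m : ℤ, Odd m ∧
      ratPlusSymbol fW ((b : ℚ) / 4 ^ k) = ratPlusSymbol fW 0 + (m : ℚ) / 2) :
    ∀ Lplus Lminus : IwasawaAlgebra 2, IsPollackPair fA 2 Lplus Lminus → ¬ PowerSeries.C (2 : ℤ_[2]) ∣ Lminus := by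
  haveI : Fact (Nat.Prime 2) := ⟨Nat.prime_two⟩
  have hnz : ∃ x : ℚ, ratPlusSymbol fA x ≠ 0 :=
    ⟨0, fun h ↦ hLA (by rw [hfA.entireLFunction_one_eq, h]; simp)⟩
  obtain ⟨S, hS, hodd, hcong⟩ := exists_plusSymbol_congruence_twist_squarefree W hmod h2 hss hd hd4 hsq hcop hA hfW hfA hnz
  have h2d : ¬ (2 : ℤ) ∣ d := by omega
  obtain ⟨hgoodA, haA⟩ := hasGoodReductionAtPrime_twist_and_frobeniusTrace_eq W 2 hmod hd4 hsq hcop hA hss.1 h2d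
  have haA0 : A.frobeniusTrace 2 = 0 := by rw [haA, haW, mul_zero]
  have hssA : GoodSS A 2 := ⟨hgoodA, by rw [haA0]; exact dvd_zero _⟩
  have h2NW : ¬ 2 ∣ W.conductorNorm ℤ := not_dvd_level_of_isNewformOf hfW hss.1
  have haW2 : cuspCoeff fW 2 = ((W.frobeniusTrace 2 : ℤ) : ℂ) := cuspCoeff_eq_frobeniusTrace_of_isNewformOf_holds hfW hss.1
  have haev : Even (W.frobeniusTrace 2) := even_iff_two_dvd.mpr hss.2
  exact SignedMuAtTwo.flatAtTwo_of_plusSymbol_congruence hfA hssA haA0 fW hfW.1 hfW.coeffField_eq_bot h2NW haW2 haev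
    S hS hodd hcong hres

/-- The same in the registered stub's currency: **every coefficient-wise reading `∃ n, IsUnit (coeff n (kobayashiL 1 L⁺ L⁻))`**
(Kobayashi's `L_p^+` is the tree's `L⁻ = L♭`). [cite: Kobayashi2003, Thm. 1.2] [cite: Pollack2003, Prop. 6.18] -/
theorem analyticMuFlat_twist_at_of_exists_odd (hmod : exists_isNewformOf)
    (h2 : Literature.NumberTheory.EllipticCurves.realPeriodRat_eq_unit_mul_plusPeriod_two)
    (hss : GoodSS W 2) (haW : W.frobeniusTrace 2 = 0) (hd : 0 < d) (hd4 : d % 4 = 1) (hsq : Squarefree d)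
    (hcop : IsCoprime d (W.conductorNorm ℤ : ℤ)) {C : VariableChange ℚ} (hA : C • W.quadraticTwist (d : ℚ) = A)
    (hfW : IsNewformOf W fW) (hfA : IsNewformOf A fA) (hLA : A.entireLFunction 1 ≠ 0)
    (hres : ∃ k : ℕ, 1 ≤ k ∧ ∃ b : ℤ, Odd b ∧ ∃ m : ℤ, Odd m ∧
      ratPlusSymbol fW ((b : ℚ) / 4 ^ k) = ratPlusSymbol fW 0 + (m : ℚ) / 2)
    (Lplus Lminus : IwasawaAlgebra 2) (hPP : IsPollackPair fA 2 Lplus Lminus) :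
    ∃ n : ℕ, IsUnit (PowerSeries.coeff n (kobayashiL 1 Lplus Lminus)) := by
  rw [kobayashiL_one]
  exact exists_isUnit_coeff_of_not_C_two_dvd
    (flatAtTwo_twist_of_exists_odd W hmod h2 hss haW hd hd4 hsq hcop hA hfW hfA hLA hres Lplus Lminus hPP)

/-- **Certificate at a SIBLING.** Same anchor `W` (good supersingular at `2`, `a₂(W) = 0`), two real square-free twists: `A₁` a globally
minimal model of `W^{(d₁)}` and `A` one of `W^{(d)}` (`d₁, d > 0` square-free, `≡ 1 (mod 4)`, coprime to `N_W`), newforms `f₁`, `f_W`, `f_A`,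
`L(A,1) ≠ 0`, `hmod`/`h2` granted. If some `[b/4^k]⁺_{f₁} − [0]⁺_{f₁}` is half an odd integer (e.g. `A₁` is level-16-certified,
`FlatLevelSixteen`), then (μ♭) holds AT `A`: transport `A₁ → W` (§3, no non-vanishing needed) then `W → A` (§4). So ONE print- or
symbol-certified member certifies the whole rank-`0` real-square-free-twist family of `W`. BSD is not proved by this.
[cite: MazurTateTeitelbaum1986Invent, §I.8] [cite: Pal2012, Thm. 3.2 (case d > 0)] [cite: Pollack2003, Prop. 6.18] -/
theorem analyticMuFlat_twist_at_of_sibling (hmod : exists_isNewformOf)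
    (h2 : Literature.NumberTheory.EllipticCurves.realPeriodRat_eq_unit_mul_plusPeriod_two)
    (hss : GoodSS W 2) (haW : W.frobeniusTrace 2 = 0)
    {d₁ : ℤ} (hd₁ : 0 < d₁) (hd₁4 : d₁ % 4 = 1) (hsq₁ : Squarefree d₁) (hcop₁ : IsCoprime d₁ (W.conductorNorm ℤ : ℤ))
    {A₁ : WeierstrassCurve ℚ} [A₁.IsElliptic] [A₁.IsGloballyMinimal] [NeZero (A₁.conductorNorm ℤ)] {C₁ : VariableChange ℚ}
    (hA₁ : C₁ • W.quadraticTwist (d₁ : ℚ) = A₁) {f₁ : CuspForm (Gamma0 (A₁.conductorNorm ℤ)) 2} (hf₁ : IsNewformOf A₁ f₁)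
    (hres : ∃ k : ℕ, 1 ≤ k ∧ ∃ b : ℤ, Odd b ∧ ∃ m : ℤ, Odd m ∧
      ratPlusSymbol f₁ ((b : ℚ) / 4 ^ k) = ratPlusSymbol f₁ 0 + (m : ℚ) / 2)
    (hd : 0 < d) (hd4 : d % 4 = 1) (hsq : Squarefree d) (hcop : IsCoprime d (W.conductorNorm ℤ : ℤ))
    {C : VariableChange ℚ} (hA : C • W.quadraticTwist (d : ℚ) = A)
    (hfW : IsNewformOf W fW) (hfA : IsNewformOf A fA) (hLA : A.entireLFunction 1 ≠ 0)
    (Lplus Lminus : IwasawaAlgebra 2) (hPP : IsPollackPair fA 2 Lplus Lminus) :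
    ∃ n : ℕ, IsUnit (PowerSeries.coeff n (kobayashiL 1 Lplus Lminus)) :=
  analyticMuFlat_twist_at_of_exists_odd W hmod h2 hss haW hd hd4 hsq hcop hA hfW hfA hLA
    (exists_odd_of_exists_odd_twist W hmod h2 hss hd₁ hd₁4 hsq₁ hcop₁ hA₁ hfW hf₁ hres) Lplus Lminus hPP

end Flat

/-! ## §5. Anchors from print: the unit zone, and the level-16 certificate at `N ≡ ±1 (mod 8)` -/

section Anchors

variable (W : WeierstrassCurve ℚ) [W.IsElliptic] [W.IsGloballyMinimal]

/-- **(μ♭) AT EVERY RANK-ZERO REAL SQUARE-FREE TWIST OF A UNIT-ZONE ANCHOR, FROM PRINT.** Grant BY NAME Burungale–Flach (`hBF`),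
modularity (`hmod`, `hLrat`), GZK (`hGZK`) and the period unit at `2` (`h2`). Let `W/ℚ` (globally minimal) be CM of analytic rank
`0`, good supersingular at `2` with `a₂(W) = 0`, IN THE UNIT ZONE (`2 ∤ #Ш(W)·∏c_ℓ(W)`); let `d > 0` be square-free with
`d ≡ 1 (mod 4)`, `(d, N_W) = 1`, and `A` a globally minimal model of `W^{(d)}` of analytic rank `0`. THEN for every newform
`f` of `A` and every Pollack pair `(L⁺, L⁻)` of `f` at `2`: `∃ n, IsUnit (coeff n (kobayashiL 1 L⁺ L⁻))` — the conclusion of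
the registered stub `stub_analyticMuFlatNonUnitCMTwo` AT `A`, whether or not `A` is in the unit zone. BSD is not proved by this.
[cite: BurungaleFlach2024, Thm. 1.1] [cite: Pal2012, Thm. 3.2 (case d > 0)] [cite: Pollack2003, Prop. 6.18] -/
theorem analyticMuFlat_twist_at_of_unitZone_anchor
    (hBF : bsdTriple_of_hasCM_of_L_one_ne_zero) (hmod : nonempty_modularParametrizationData)
    (hLrat : hasEntireLFunction_rat) (hGZK : rank_eq_analyticRank_of_analyticRank_le_one)
    (h2 : Literature.NumberTheory.EllipticCurves.realPeriodRat_eq_unit_mul_plusPeriod_two)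
    (hcm : W.HasCM) (hrW : W.analyticRank = 0) (hss : GoodSS W 2) (haW : W.frobeniusTrace 2 = 0)
    (hunit : ¬ 2 ∣ W.shaOrder * W.tamagawaProduct)
    {d : ℤ} (hd : 0 < d) (hd4 : d % 4 = 1) (hsq : Squarefree d) (hcop : IsCoprime d (W.conductorNorm ℤ : ℤ))
    (A : WeierstrassCurve ℚ) [A.IsElliptic] [A.IsGloballyMinimal] {C : VariableChange ℚ}
    (hA : C • W.quadraticTwist (d : ℚ) = A) (hrA : A.analyticRank = 0) :
    ∀ [NeZero (A.conductorNorm ℤ)] (f : CuspForm (Gamma0 (A.conductorNorm ℤ)) 2), IsNewformOf A f →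
      ∀ (Lplus Lminus : IwasawaAlgebra 2), IsPollackPair f 2 Lplus Lminus →
        ∃ n : ℕ, IsUnit (PowerSeries.coeff n (kobayashiL 1 Lplus Lminus)) := by
  intro _ fA hfA Lplus Lminus hPP
  haveI : NeZero (W.conductorNorm ℤ) := ⟨(W.conductorNorm_pos_holds).ne'⟩
  have hmod' : exists_isNewformOf := exists_isNewformOf_of_nonempty_modularParametrizationData hmod
  obtain ⟨fW, hfW⟩ := hmod' W
  have hres := FlatTwist.exists_odd_of_unitZone W hBF hLrat hGZK h2 hcm hrW hss haW hunit hfW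
  have hLA : A.entireLFunction 1 ≠ 0 := (A.analyticRank_eq_zero_iff_holds (hLrat A)).mp hrA
  exact analyticMuFlat_twist_at_of_exists_odd W hmod' h2 hss haW hd hd4 hsq hcop hA hfW hfA hLA hres Lplus Lminus hPP

/-- **(μ♭) AT EVERY RANK-ZERO REAL SQUARE-FREE TWIST OF A LEVEL-16 ANCHOR, FROM PRINT.** As above, with the anchor `W` (CM,
analytic rank `0`, good supersingular at `2`, `a₂ = 0`) now OFF the unit zone but at conductor `N_W ≡ ±1 (mod 8)` with
`ord₂ #Ш(W) + ord₂ ∏c_ℓ(W) = 1` (`FlatLevelSixteen.exists_odd_sixteenth_of_padicValRat_eq_one`: `[b/16]⁺ − [0]⁺` is half an odd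
integer). E.g. (census) the rank-`0` real square-free twists of 441a, 1089a/b, 225b, … such as 11025e = 441a ⊗ (5/·), 27225a = 1089a ⊗
(5/·) — classes whose own certificate sits at level `64`. BSD is not proved by this. [cite: BurungaleFlach2024, Thm. 1.1]
[cite: Pal2012, Thm. 3.2 (case d > 0)] [cite: AtkinLehner1970, Thm. 3] [cite: Pollack2003, Prop. 6.18] -/
theorem analyticMuFlat_twist_at_of_levelSixteen_anchor
    (hBF : bsdTriple_of_hasCM_of_L_one_ne_zero) (hmod : nonempty_modularParametrizationData)
    (hLrat : hasEntireLFunction_rat) (hGZK : rank_eq_analyticRank_of_analyticRank_le_one)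
    (h2 : Literature.NumberTheory.EllipticCurves.realPeriodRat_eq_unit_mul_plusPeriod_two)
    (hcm : W.HasCM) (hrW : W.analyticRank = 0) (hss : GoodSS W 2) (haW : W.frobeniusTrace 2 = 0)
    (hN : W.conductorNorm ℤ % 8 = 1 ∨ W.conductorNorm ℤ % 8 = 7)
    (hz : padicValNat 2 W.shaOrder + padicValNat 2 W.tamagawaProduct = 1)
    {d : ℤ} (hd : 0 < d) (hd4 : d % 4 = 1) (hsq : Squarefree d) (hcop : IsCoprime d (W.conductorNorm ℤ : ℤ))
    (A : WeierstrassCurve ℚ) [A.IsElliptic] [A.IsGloballyMinimal] {C : VariableChange ℚ}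
    (hA : C • W.quadraticTwist (d : ℚ) = A) (hrA : A.analyticRank = 0) :
    ∀ [NeZero (A.conductorNorm ℤ)] (f : CuspForm (Gamma0 (A.conductorNorm ℤ)) 2), IsNewformOf A f →
      ∀ (Lplus Lminus : IwasawaAlgebra 2), IsPollackPair f 2 Lplus Lminus →
        ∃ n : ℕ, IsUnit (PowerSeries.coeff n (kobayashiL 1 Lplus Lminus)) := by
  intro _ fA hfA Lplus Lminus hPP
  haveI : Fact (Nat.Prime 2) := ⟨Nat.prime_two⟩
  haveI : NeZero (W.conductorNorm ℤ) := ⟨(W.conductorNorm_pos_holds).ne'⟩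
  have hmod' : exists_isNewformOf := exists_isNewformOf_of_nonempty_modularParametrizationData hmod
  obtain ⟨fW, hfW⟩ := hmod' W
  have hL : W.entireLFunction 1 ≠ 0 := (W.analyticRank_eq_zero_iff_holds (hLrat W)).mp hrW
  have hw : W.rootNumber = 1 := WeierstrassCurve.rootNumber_eq_one_of_entireLFunction_one_ne_zero hL
  have hFr : IsFrickeEigen (W.conductorNorm ℤ) fW (-((1 : ℤ) : ℂ)) := by
    have h := hfW.isFrickeEigen_neg_rootNumber
    rwa [hw] at h
  have hap : cuspCoeff fW 2 = ((0 : ℤ) : ℂ) := by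
    rw [cuspCoeff_eq_frobeniusTrace_of_isNewformOf_holds hfW hss.1, haW]
  have h2N : ¬ 2 ∣ W.conductorNorm ℤ := not_dvd_level_of_isNewformOf hfW hss.1
  have hv : padicValRat 2 (ratPlusSymbol fW 0) = 1 := by
    rw [FlatLevelSixteen.padicValRat_ratPlusSymbol_zero_eq_of_pub W hBF hLrat hGZK h2 hcm hrW hss hfW]
    exact_mod_cast hz
  have hres := FlatLevelSixteen.exists_odd_sixteenth_of_padicValRat_eq_one hfW.1 hfW.coeffField_eq_bot h2N hap hFr hN hv
  have hLA : A.entireLFunction 1 ≠ 0 := (A.analyticRank_eq_zero_iff_holds (hLrat A)).mp hrA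
  exact analyticMuFlat_twist_at_of_exists_odd W hmod' h2 hss haW hd hd4 hsq hcop hA hfW hfA hLA hres Lplus Lminus hPP

end Anchors

/-! ## §6. From FLAT in door form back to the residual certificate (rank `0`), and transport from a door-certified anchor -/

/-- **FLAT (door form) ⟹ residual certificate**, in analytic rank `0`: for `W` good supersingular at `2` with `a₂(W) = 0`,
`L(W,1) ≠ 0` (so a Pollack pair exists) and newform `f`, if `2 ∤ L♭` for every Pollack pair at `2` then some
`[b/4^k]⁺_f − [0]⁺_f` (`k ≥ 1`, `b` odd) is half an ODD integer — the FlatSymbols reading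
(`flatAtTwo_iff_exists_norm_ratPlusSymbol_eq_two`: some `|[5^s/2^{n+2}]⁺_f|₂ = 2`, `n` even) with `b = 5^s mod 2^{n+2}` (odd),
`4^k = 2^{n+2}`, and `[0]⁺_f ∈ ℤ₍₂₎` (`3[0]⁺_f ∈ ℤ`). So ANY door-form FLAT source at a rank-`0` anchor (an RTT (G′)_N
certificate, the Zhai door, …) feeds the twist transport. [cite: Pollack2003, Prop. 6.18] [cite: MazurTateTeitelbaum1986Invent, §I.8, §I.13] -/
theorem exists_odd_of_flatAtTwo {W : WeierstrassCurve ℚ} [W.IsElliptic] [W.IsGloballyMinimal] [NeZero (W.conductorNorm ℤ)]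
    {f : CuspForm (Gamma0 (W.conductorNorm ℤ)) 2} (hf : IsNewformOf W f) (hss : GoodSS W 2)
    (ha : W.frobeniusTrace 2 = 0) (hr : W.analyticRank = 0)
    (hflat : ∀ Lplus Lminus : IwasawaAlgebra 2, IsPollackPair f 2 Lplus Lminus → ¬ PowerSeries.C (2 : ℤ_[2]) ∣ Lminus) :
    ∃ k : ℕ, 1 ≤ k ∧ ∃ b : ℤ, Odd b ∧ ∃ m : ℤ, Odd m ∧
      ratPlusSymbol f ((b : ℚ) / 4 ^ k) = ratPlusSymbol f 0 + (m : ℚ) / 2 := by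
  haveI : Fact (Nat.Prime 2) := ⟨Nat.prime_two⟩
  obtain ⟨n, ⟨j, hj⟩, s, hnorm⟩ := (SignedMuAtTwo.flatAtTwo_iff_exists_norm_ratPlusSymbol_eq_two hf hss ha hr).mp hflat
  have h2N : ¬ 2 ∣ W.conductorNorm ℤ := not_dvd_level_of_isNewformOf hf hss.1
  have hreal : ∀ n, (cuspCoeff f n).im = 0 := cuspCoeff_im_eq_zero_of_coeffField_eq_bot hf.coeffField_eq_bot
  have ha₂ : cuspCoeff f 2 = 0 := by rw [cuspCoeff_eq_frobeniusTrace_of_isNewformOf_holds hf hss.1, ha]; simp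
  set c : ℕ := (((cyclotomicGenerator 2 : ZMod (2 ^ (n + 2))) ^ s.val).val) with hc_def
  -- `c` is odd
  have hcodd : Odd c := by
    have hcv : c = (cyclotomicGenerator 2 ^ s.val) % 2 ^ (n + 2) := by
      rw [hc_def, ← Nat.cast_pow, ZMod.val_natCast]
    rw [hcv, cyclotomicGenerator_two]
    exact (Odd.pow (by decide : Odd 5)).mod_even (by rw [Nat.even_pow]; exact ⟨even_two, by omega⟩)
  -- `2^{n+2} = 4^{j+1}`
  have hpow : (2 : ℚ) ^ (n + 2) = 4 ^ (j + 1) := by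
    rw [hj, show (4 : ℚ) = 2 ^ 2 by norm_num, ← pow_mul]; congr 1; omega
  have hy : ((((cyclotomicGenerator 2 : ZMod (2 ^ (n + 2))) ^ s.val).val : ℚ) / (2 : ℚ) ^ (n + 2)) =
      ((c : ℤ) : ℚ) / 4 ^ (j + 1) := by rw [hpow, hc_def]; push_cast; rfl
  rw [hy] at hnorm
  -- `[b/4^k] = [0] + m/2`; `m` must be odd since `[0] ∈ ℤ₍₂₎` and the norm is `2`
  have hx : (((c : ℤ) : ℚ) / 4 ^ (j + 1)).den.Coprime (W.conductorNorm ℤ) := by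
    have h4 : ((4 : ℚ) ^ (j + 1)) = 2 ^ (2 * (j + 1)) := by rw [pow_mul]; norm_num
    rw [h4]; exact SignedMuAtTwo.coprime_den_div_two_pow h2N c (2 * (j + 1))
  obtain ⟨m, hm⟩ := exists_ratPlusSymbol_eq_add_div_two f hreal hx
  obtain ⟨t, ht⟩ := exists_three_mul_ratPlusSymbol_zero_eq_intCast hf.1 hreal h2N ha₂
  have h0norm : ‖((ratPlusSymbol f 0 : ℚ) : ℚ_[2])‖ ≤ 1 := by
    have h3 : ‖((3 : ℤ) : ℚ_[2])‖ = 1 := by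
      have hle := Padic.norm_int_le_one (p := 2) 3
      have hnlt : ¬ ‖((3 : ℤ) : ℚ_[2])‖ < 1 := fun h ↦ by
        have h' := (Padic.norm_intCast_lt_one_iff (p := 2) (k := 3)).mp h
        omega
      exact le_antisymm hle (not_lt.mp hnlt)
    have h3s : ‖(((3 * ratPlusSymbol f 0 : ℚ)) : ℚ_[2])‖ ≤ 1 := by
      rw [ht]
      exact_mod_cast Padic.norm_int_le_one (p := 2) t
    have hmul : (((3 * ratPlusSymbol f 0 : ℚ)) : ℚ_[2]) = ((3 : ℤ) : ℚ_[2]) * ((ratPlusSymbol f 0 : ℚ) : ℚ_[2]) := by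
      push_cast; ring
    rw [hmul, norm_mul, h3, one_mul] at h3s
    exact h3s
  refine ⟨j + 1, by omega, c, by exact_mod_cast hcodd, m, ?_, hm⟩
  by_contra hmev
  rw [Int.not_odd_iff_even] at hmev
  obtain ⟨m', rfl⟩ := hmev
  have hval : ratPlusSymbol f (((c : ℤ) : ℚ) / 4 ^ (j + 1)) = ratPlusSymbol f 0 + (m' : ℚ) := by rw [hm]; push_cast; ring
  rw [hval, Rat.cast_add] at hnorm
  have hle := (Padic.nonarchimedean ((ratPlusSymbol f 0 : ℚ) : ℚ_[2]) ((m' : ℚ) : ℚ_[2])).trans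
    (max_le h0norm (by rw [Rat.cast_intCast]; exact Padic.norm_int_le_one _))
  rw [hnorm] at hle
  norm_num at hle

variable (W : WeierstrassCurve ℚ) [W.IsElliptic] [W.IsGloballyMinimal] {d : ℤ} {A : WeierstrassCurve ℚ}
  [A.IsElliptic] [A.IsGloballyMinimal] [NeZero (W.conductorNorm ℤ)] [NeZero (A.conductorNorm ℤ)]
  {fW : CuspForm (Gamma0 (W.conductorNorm ℤ)) 2} {fA : CuspForm (Gamma0 (A.conductorNorm ℤ)) 2}

/-- **(μ♭) AT every rank-`0` real square-free twist of a rank-`0` anchor that is FLAT in door form** (`2 ∤ L♭` for every Pollack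
pair of `f_W` at `2` — e.g. supplied by an RTT (G′)_{N_W} certificate `SignedMuAtTwo.flatAtTwo_of_cuspSpan`), granted `hmod`, `h2`.
[cite: Pollack2003, Prop. 6.18] [cite: Pal2012, Thm. 3.2 (case d > 0)] [cite: MazurTateTeitelbaum1986Invent, §I.8] -/
theorem analyticMuFlat_twist_at_of_flatAtTwo_anchor (hmod : exists_isNewformOf)
    (h2 : Literature.NumberTheory.EllipticCurves.realPeriodRat_eq_unit_mul_plusPeriod_two)
    (hss : GoodSS W 2) (haW : W.frobeniusTrace 2 = 0) (hrW : W.analyticRank = 0)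
    (hflat : ∀ Lplus Lminus : IwasawaAlgebra 2, IsPollackPair fW 2 Lplus Lminus → ¬ PowerSeries.C (2 : ℤ_[2]) ∣ Lminus)
    (hd : 0 < d) (hd4 : d % 4 = 1) (hsq : Squarefree d) (hcop : IsCoprime d (W.conductorNorm ℤ : ℤ))
    {C : VariableChange ℚ} (hA : C • W.quadraticTwist (d : ℚ) = A)
    (hfW : IsNewformOf W fW) (hfA : IsNewformOf A fA) (hLA : A.entireLFunction 1 ≠ 0)
    (Lplus Lminus : IwasawaAlgebra 2) (hPP : IsPollackPair fA 2 Lplus Lminus) :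
    ∃ n : ℕ, IsUnit (PowerSeries.coeff n (kobayashiL 1 Lplus Lminus)) :=
  analyticMuFlat_twist_at_of_exists_odd W hmod h2 hss haW hd hd4 hsq hcop hA hfW hfA hLA
    (exists_odd_of_flatAtTwo hfW hss haW hrW hflat) Lplus Lminus hPP

end FlatTwist.Squarefree

end Summit.BirchSwinnertonDyer.BirchSwinnertonDyer.Theorems

end
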